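import Literature.NumberTheory.EllipticCurves.KramerTunnell1982.NormIndexNeronModels
import HarnessLib

/-!
# Cell `bsd-f1-sign2`, DESC-§26 (-desc g18): the quadratic norm index at `2` IS Kramer–Tunnell 1982 Theorem 7.6 —
# its explicit Kodaira–Tamagawa form over `ℚ₂` (DESC-KT76-Q2), the unramified clause (DESC-KT76-unr = Cor. 7.6) and the
# general ramified clause (DESC-KT76-ram); COROLLARIES OF PRINT, typed as plain `def`s + one PROVED derivation

PORT (cell `bsd-f1-sign2`, seat `-ty` g12, asks D-desc-63/65) of -desc g18's sketch `MEMO-desc-data/g18/lean/SketchG18NormIndex.lean`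
05cb8e20218af5fd (MEMO-desc §26 + add1/add2, memo fbdc6ce157d3839f; rc 0·0·0·0; BC7 3/3 CLEAN `ProbeG18NormIndex.verdict.txt`
b3e5e701681a4471): the three `def` bodies VERBATIM; typer edits = this header, the import (the sketch's three Literature imports ↦ the
landed fact file `Literature/NumberTheory/EllipticCurves/KramerTunnell1982/NormIndexNeronModels.lean`, p667240, commit f76af768ce73:
`KramerTunnell1982.thm76_normIndexNeronModels`, `KramerTunnell1982.cor76_normIndex_eq_tamagawaRatio`), the status/census sentences and
cite tags appended to the three docstrings (REF1 §138 R2/R3), the derivation `unramifiedNormIndexTamagawa_of_cor76` (R1, proof = REF1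
probe P6), and the OMISSION of the sketch's content-free shape def `ramifiedAtTwo_of_general_shape` (R4: the `ℚ₂` clause ⇐ general clause
is a real lemma — `δ(F(√d)/F) = 2 + v(d)` for `F ≅ ℚ₂`, `ϖ = 1 + √d` resp. `√d` — for a prover, `--supports` the row). No `sorry`, no
`@[conjecture]` (nothing here is a conjecture), no instance, no notation; nothing asserted beyond the one derivation. BSD is not
proved; 23715 not closed.

SCOPE (REF1 §138 R5): `RamifiedNormIndexKodairaTamagawaAtTwo` is the `F ≅ ℚ₂`, `δ = 2 + v(d)` INSTANCE of `RamifiedNormIndexKodairaTamagawa`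
(`12e = 4δ + 1 + m_K − m − m′` ↦ `9 + 4v(d) + m_K − m − m′`); the bound `e ∈ {0, 1}` seen on all 70 783 ramified census rows
(-desc's «residual-bit bound», words only) is an OBSERVATION and is not typed.

The planner's summary (verbatim, sketch header): «Kramer–Tunnell 1982 Thm 7.6 (Compositio 46, p. 332): `#E(F)/N E(K) = (c_F · c^ω_F /
c_K) · ‖u_K‖_K / (‖u_F‖_F ‖u^ω_F‖_F)` (`u` = the stretching factors to minimal models); Remark p. 333: "We leave it to the reader to
express this in terms of conductors and numbers of components in the singular fibers of the Néron models."  Doing the exercise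
(Ogg–Saito for `E/F`, `E^ω/F`, `E/K` + the conductor of `Ind_K^F` = `a(E) + a(E^ω) = f·a(E/K) + 2 v_F(𝔡_{K/F})`) gives, for `K/F` a
RAMIFIED separable quadratic extension of ANY nonarchimedean local field `F` (`q = #k_F`, `δ = v_F(𝔡_{K/F})`, `m(·)` = number of
geometric components of the Néron special fibre, `c(·)` = Tamagawa number): `#E(F)/N E(K) = (c(E/F) c(E^ω/F) / c(E/K)) · q^{(4δ + 1 +
m(E/K) − m(E/F) − m(E^ω/F))/12}`, and for `K/F` unramified (KT82 Cor. 7.6, p. 334): `#E(F)/N E(K) = c(E/F) c(E^ω/F) / c(E/K)`. Over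
`F = ℚ₂`: `δ = 2 + v₂(d)`, so the exponent is `(9 + 4 v₂(d) + m_K − m − m')/12`. Census (MEMO-desc §26): 34 213 (curve, d) rows of the
g17 ENGINE-1 outputs, 0 exceptions.»  Later census (MEMO-desc §26-add1/add2, `MEMO-desc-data/g18/tamcheck-ALL.txt` bd3255c65817b062):
82 576/82 576 (curve, d) rows on FOUR populations (§25's kit j315771 X5-additive + j316261 random + j313927 smoke (all reduction blocks)
+ REF1's disjoint j316919, 6 909 curves): 70 783 ramified + 11 793 unramified, 11 817 curves, 0 exceptions; KT's printed Example
(24A × four ramified fields, p. 334) reproduced.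

REF1 §138 (refuter-bsd-f1-sign2-ref1 g13, `HOME/REF1-AUDIT-v1.md` l.2671, evidence `REF1-data/b138/` SHA16.txt, 2026-08-28T20:47Z; D-desc-66 =
the -ty filing gate, GREEN with riders R1–R5, all applied here), ONE LINE verbatim: «5/5 SURVIVE as typed; all five are PRINT or
corollary-of-print (no conjecture content): `RamifiedNormIndexKodairaTamagawaAtTwo` (Q2) and `RamifiedNormIndexKodairaTamagawa` (ram)
THEOREM-GRADE corollaries of KT82 Thm 7.6 + Remark p. 333 ∘ Ogg–Saito ×3 ∘ the conductor of an induced representation;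
`UnramifiedNormIndexTamagawa` (unr) = the unramified disjunct of Cor. 7.6 (kernel: REF1 probe P6 proves `cor76_normIndex_eq_tamagawaRatio
→ UnramifiedNormIndexTamagawa` by binder matching, rc 0); the two draft facts are faithful transcriptions of Thm 7.6/Remark p. 333
(model-free form) and Cor. 7.6 (p. 334). REF1 independent replay (own code `REF1-data/b138/rep/kt76check_ref1.py`): 82 576 / 82 576
(curve, d) rows, 0 exceptions (70 783 ramified: Kodaira form AND model-free form agree row by row, e ∈ {0: 31 507, 1: 39 276}; 11 793
unramified …); -desc's grade «KNOWN / corollary-of-print; beyond-print NO; PARTITION none» CONFIRMED.»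
REF2 v40-add6 §4 = REF2_TXT_DESC26 (refuter-bsd-f1-sign2-ref2 g40, `HOME/REF2-PLACEMENT-v40-add6.md` 325c018fb6c22cbd, 2026-08-28T20:26:58Z;
supersedes REF2_TXT_DESC25), verbatim: «REF2 v40-add6 (refuter-bsd-f1-sign2-ref2 g40, `HOME/REF2-PLACEMENT-v40-add6.md`), placement: the
exact local norm index #E(F)/N E(K) for any elliptic curve over any non-archimedean local field F with finite residue field and any
quadratic K/F is a printed theorem — [KramerTunnell1982, Thm. 7.6 (p. 332): |E(F)/NE(K)| = (c_F c′_F/c_K)·‖u_K‖_K/(‖u_F‖_F ‖u′_F‖_F);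
Remark p. 333 (model-free, «we leave it to the reader to express this in terms of conductors and numbers of components»); Cor. 7.6
(p. 334: K/F unramified or char k_F ≠ 2 ⇒ c_F c′_F/c_K); Example p. 334 (24A, type III over ℚ₂, ramified K); p. 347 (types IV/IV*)].
The rows `UnramifiedNormIndexTamagawa` (= Cor. 7.6) and `RamifiedNormIndexKodairaTamagawa[AtTwo]` (= Thm. 7.6 with the reader's
exercise done via Ogg–Saito [Ogg1967; Saito1988] and [SerreLocalFields1979, VI §3 Prop. 6 (b)]) are KNOWN / corollaries of print,
confirmed on 82 576/82 576 census rows (MEMO-desc §26.3; REF1 §136.6); beyond-print: no. The Kramer–Tunnell sign is a theorem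
[DokchitserDokchitser2011, Thm. 5]. DESC-L (§25) is the ℚ₂-side shadow of Thm. 7.6 composed with an unprinted base-change regularity
of Néron models under wild quadratic extension (documentation-grade); DESC-N a variant of the Kramer/2-descent local analysis
([SilvermanAEC2009, X.4.9]; [Kramer1981, Props. 1–7]; [Klagsbrun2016, Lemma 2.4, Prop. 3.2]); DESC-C local-duality folklore; DESC-F/F2
new-combination-small. Česnavičius–Imai 2016 p. 3 («difficult to isolate the norm index term») concerns the root-number side.»
[cite: KramerTunnell1982, Thm. 7.6, Remark p. 333, Cor. 7.6] [cite: Saito1988] [cite: Ogg1967] [cite: SerreLocalFields1979, VI §3 Prop. 6 (b)]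
[cite: DokchitserDokchitser2011, Thm. 5]
PARTITION: none moved; beyond-print theorem: no (corollaries of print; the `ℚ₂`/ram rows become tree theorems once Ogg–Saito and the
induced-conductor formula are kernel facts); BSD not proved; 23715 not closed; bears_on: stmt-BirchSwinnertonDyer-23715.
-/

noncomputable section

open ValuativeRel Field
open Literature.NumberTheory.GaloisRepresentations.IsNonarchimedeanLocalField
open Literature.NumberTheory.DiophantineGeometry
open Literature.NumberTheory.EllipticCurves.KramerTunnell1982

namespace Summit.BirchSwinnertonDyer.Rank1Residual.F1Sign2

open scoped Classical


/-- **DESC-KT76-Q2 (the ramified quadratic norm index over `ℚ₂` in Kodaira–Tamagawa form; COROLLARY of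
Kramer–Tunnell 1982 Thm 7.6 + Ogg–Saito; MEMO-desc §26).** `F ≅ ℚ₂` (characteristic `0`, residue field `𝔽₂`,
`2` a uniformiser); `E/F` ANY elliptic curve; `d ∈ 𝒪_F` a non-square which is a unit or a uniformiser;
`K' ⊇ F(√d)` a quadratic extension which is a local field with residue field `𝔽₂` (i.e. `K'/F` RAMIFIED; `F → K'`
continuous);
`σ` its non-trivial `F`-automorphism. With `c = c(E/F)`, `c' = c(E^d/F)`, `c_K = c(E/K')` (Tamagawa numbers) and
`m, m', m_K` the numbers of geometric components of the special fibres (Kodaira symbols) of `E/F`, `E^d/F`, `E/K'`: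
`#E(F)/N E(K') · c_K = c · c' · 2^e` with `12 e = 9 + 4 v(d) + m_K − m − m'` (`v(d) = 0` for a unit, `1` for a
uniformiser). In particular `m + m' − m_K ≡ 9 + 4 v(d) (mod 12)` and the index is a function of
`(Kod, c)(E/F), (Kod, c)(E^d/F), (Kod, c)(E/K')` — this EXPLAINS the g17 data law DESC-L (K7 table, 209 classes).
Status (REF1 §138 R2): a COROLLARY OF PRINT — [KramerTunnell1982, Thm. 7.6 + Remark p. 333] (tree fact
`KramerTunnell1982.thm76_normIndexNeronModels`) ∘ Ogg–Saito `v(Δ_min) = a + m − 1` in every residue characteristic [Saito1988]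
∘ the conductor of an induced representation `a(E) + a(E^d) = f·a(E/K′) + 2δ` [SerreLocalFields1979, VI §3 Prop. 6 (b)], with
`δ(F(√d)/F) = 2 + v(d)` for `F ≅ ℚ₂`; NOT a conjecture and nothing here is «not in print». `relIndex` is the honest (finite)
index: `E(F)/NE(K′)` is finite [KramerTunnell1982, Cor. 7.3.1], so the `ℚ`-equation is never satisfied by the junk value `0`.
`(_hc : CharZero F)` is redundant (implied by `Irreducible (2 : 𝒪[F])`; kept verbatim from the sketch, REF1 §138 R3).
Census: 82 576/82 576 (curve, d) rows, 0 exceptions (-desc `MEMO-desc-data/g18/tamcheck-ALL.txt` bd3255c65817b062 on four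
populations; REF1 independent replay `REF1-data/b138/out/kt76check.out` 14040871549acfb2, e ∈ {0: 31 507, 1: 39 276} on the
70 783 ramified rows — the bound `e ∈ {0,1}` is an OBSERVATION, not typed).
[cite: KramerTunnell1982, Thm. 7.6] [cite: Saito1988] [cite: SerreLocalFields1979, VI §3 Prop. 6 (b)] -/
def RamifiedNormIndexKodairaTamagawaAtTwo : Prop :=
  ∀ (F : Type) [Field F] [ValuativeRel F] [TopologicalSpace F] [IsNonarchimedeanLocalField F]
    (_hc : CharZero F) (_hk : Nat.card (IsLocalRing.ResidueField 𝒪[F]) = 2) (_h2 : Irreducible (2 : 𝒪[F]))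
    (E : WeierstrassCurve F) [E.IsElliptic]
    (d : 𝒪[F]) (_hd : ¬ IsSquare (d : F)) (_hdv : IsUnit d ∨ Irreducible d)
    (K' : Type) [Field K'] [ValuativeRel K'] [TopologicalSpace K'] [IsNonarchimedeanLocalField K']
    [Algebra F K'] (_hcont : Continuous (algebraMap F K')) (_hK : Module.finrank F K' = 2)
    (_hram : Nat.card (IsLocalRing.ResidueField 𝒪[K']) = 2)
    (σ : K' ≃ₐ[F] K') (_hσ : σ ≠ 1) (x : K') (_hx : x ^ 2 = algebraMap F K' d),
    let c : ℕ := E.localTamagawaNumber 𝒪[F]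
    let c' : ℕ := (E.quadraticTwist (d : F)).localTamagawaNumber 𝒪[F]
    let cK : ℕ := (E.baseChange K').localTamagawaNumber 𝒪[K']
    let m : ℕ := (E.kodairaSymbol 𝒪[F]).numComponents
    let m' : ℕ := ((E.quadraticTwist (d : F)).kodairaSymbol 𝒪[F]).numComponents
    let mK : ℕ := ((E.baseChange K').kodairaSymbol 𝒪[K']).numComponents
    let vd : ℤ := if IsUnit d then 0 else 1
    ∃ e : ℤ, 12 * e = 9 + 4 * vd + mK - m - m' ∧
      ((normSubgroup E K' σ).relIndex (fixedSubgroup E K' σ) : ℚ) * cK = c * c' * (2 : ℚ) ^ e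

/-- **DESC-KT76-unr (Kramer–Tunnell 1982 Corollary 7.6, p. 334, unramified clause; MEMO-desc §24-add2 / §26).**
`F` ANY nonarchimedean local field, `E/F` any elliptic curve, `K' ⊇ F(√d)` an UNRAMIFIED quadratic extension
(a local field whose residue field has `q²` elements, `q = #k_F`, `F → K'` continuous), `σ ≠ 1`, `2 ≠ 0` in `F` (the
tree's `quadraticTwist` is the characteristic-`≠ 2` formula; the source also covers Artin–Schreier twists): `#E(F)/N E(K') · c(E/K') = c(E/F) · c(E^d/F)`.
Status (REF1 §138 R1, REF2 add6): KNOWN = the unramified disjunct of the tree fact `KramerTunnell1982.cor76_normIndex_eq_tamagawaRatio`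
— DERIVED below (`unramifiedNormIndexTamagawa_of_cor76`, binder matching; REF1 probe P6). [cite: KramerTunnell1982, Cor. 7.6] -/
def UnramifiedNormIndexTamagawa : Prop :=
  ∀ (F : Type) [Field F] [ValuativeRel F] [TopologicalSpace F] [IsNonarchimedeanLocalField F]
    (_h2F : (2 : F) ≠ 0) (E : WeierstrassCurve F) [E.IsElliptic] (d : F) (_hd : ¬ IsSquare d)
    (K' : Type) [Field K'] [ValuativeRel K'] [TopologicalSpace K'] [IsNonarchimedeanLocalField K']
    [Algebra F K'] (_hcont : Continuous (algebraMap F K')) (_hK : Module.finrank F K' = 2)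
    (_hunr : Nat.card (IsLocalRing.ResidueField 𝒪[K']) = Nat.card (IsLocalRing.ResidueField 𝒪[F]) ^ 2)
    (σ : K' ≃ₐ[F] K') (_hσ : σ ≠ 1) (x : K') (_hx : x ^ 2 = algebraMap F K' d),
    (normSubgroup E K' σ).relIndex (fixedSubgroup E K' σ) * (E.baseChange K').localTamagawaNumber 𝒪[K'] =
      E.localTamagawaNumber 𝒪[F] * (E.quadraticTwist d).localTamagawaNumber 𝒪[F]

/-- **DESC-KT76-unr is the unramified disjunct of Kramer–Tunnell 1982 Cor. 7.6** (tree fact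
`KramerTunnell1982.cor76_normIndex_eq_tamagawaRatio`): binder matching, REF1 §138 probe P6. PROVED (modulo the named fact). [cite: KramerTunnell1982, Cor. 7.6] -/
theorem unramifiedNormIndexTamagawa_of_cor76 (h : cor76_normIndex_eq_tamagawaRatio) : UnramifiedNormIndexTamagawa := by
  intro F _ _ _ _ h2F E _ d hd K' _ _ _ _ _ hcont hK hunr σ hσ x hx
  exact h F h2F E d hd K' hcont hK σ hσ x hx (Or.inl hunr)

/-- **DESC-KT76-ram (general ramified clause in Kodaira–Tamagawa form; COROLLARY of KT82 Thm 7.6 + Ogg–Saito +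
the conductor of an induced representation; MEMO-desc §26).** `F` ANY nonarchimedean local field (`q = #k_F`, any
residue characteristic), `E/F` any elliptic curve, `K' ⊇ F(√d)` a RAMIFIED quadratic extension (residue field of
`K'` = that of `F` in size, `F → K'` continuous), `2 ≠ 0` in `F`, `σ ≠ 1`, `ϖ` a uniformiser of `K'` and `δ` the different exponent
(`ϖ − σϖ = unit · ϖ^δ`; `δ = v_F(disc K'/F)`; `δ = 1` in odd residue characteristic). Then
`#E(F)/N E(K') · c(E/K') = c(E/F) · c(E^d/F) · q^e`, `12 e = 4δ + 1 + m(E/K') − m(E/F) − m(E^d/F)`.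
(Odd residue characteristic: `e = 0`, i.e. `m(E/F) + m(E^d/F) = m(E/K') + 5` and the index is `c c'/c_K`, KT82 Cor. 7.6.)
Status (REF1 §138 R2): THEOREM-GRADE COROLLARY OF PRINT — `KramerTunnell1982.thm76_normIndexNeronModels` with `f = 1`
(`12e = 6δ + v_K(Δ_K) − v(Δ) − v(Δ′)`) ∘ [Saito1988] (Ogg's formula ×3) ∘ [SerreLocalFields1979, VI §3 Prop. 6 (b)]
(`a + a′ = a_K + 2δ`) gives `12e = 4δ + 1 + m_K − m − m′`; weaker than print only in excluding Artin–Schreier `K′/F`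
(`2 ≠ 0`). `𝒪_{K′} = 𝒪_F[ϖ]` for a totally ramified `K′/F` [SerreLocalFields1979, I §6 Prop. 18], so `𝔇 = (ϖ − σϖ)` and
`δ = v_F(𝔡_{K′/F}) = v_{K′}(ϖ − σϖ)` [SerreLocalFields1979, III §6 Cor. 2 of Prop. 11, III §3 Prop. 6]. Finite index: [KramerTunnell1982, Cor. 7.3.1].
Census as for the `ℚ₂` clause (82 576/82 576). [cite: KramerTunnell1982, Thm. 7.6] [cite: Saito1988] [cite: SerreLocalFields1979, VI §3 Prop. 6 (b)] -/
def RamifiedNormIndexKodairaTamagawa : Prop :=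
  ∀ (F : Type) [Field F] [ValuativeRel F] [TopologicalSpace F] [IsNonarchimedeanLocalField F]
    (_h2F : (2 : F) ≠ 0) (E : WeierstrassCurve F) [E.IsElliptic] (d : F) (_hd : ¬ IsSquare d)
    (K' : Type) [Field K'] [ValuativeRel K'] [TopologicalSpace K'] [IsNonarchimedeanLocalField K']
    [Algebra F K'] (_hcont : Continuous (algebraMap F K')) (_hK : Module.finrank F K' = 2)
    (_hram : Nat.card (IsLocalRing.ResidueField 𝒪[K']) = Nat.card (IsLocalRing.ResidueField 𝒪[F]))
    (σ : K' ≃ₐ[F] K') (_hσ : σ ≠ 1) (x : K') (_hx : x ^ 2 = algebraMap F K' d)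
    (ϖ : 𝒪[K']) (_hϖ : Irreducible ϖ) (δ : ℕ)
    (_hδ : ∃ u : 𝒪[K'], IsUnit u ∧ (ϖ : K') - σ (ϖ : K') = (u : K') * (ϖ : K') ^ δ),
    let q : ℕ := Nat.card (IsLocalRing.ResidueField 𝒪[F])
    let c : ℕ := E.localTamagawaNumber 𝒪[F]
    let c' : ℕ := (E.quadraticTwist d).localTamagawaNumber 𝒪[F]
    let cK : ℕ := (E.baseChange K').localTamagawaNumber 𝒪[K']
    let m : ℕ := (E.kodairaSymbol 𝒪[F]).numComponents
    let m' : ℕ := ((E.quadraticTwist d).kodairaSymbol 𝒪[F]).numComponents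
    let mK : ℕ := ((E.baseChange K').kodairaSymbol 𝒪[K']).numComponents
    ∃ e : ℤ, 12 * e = 4 * (δ : ℤ) + 1 + mK - m - m' ∧
      ((normSubgroup E K' σ).relIndex (fixedSubgroup E K' σ) : ℚ) * cK = c * c' * (q : ℚ) ^ e

end Summit.BirchSwinnertonDyer.Rank1Residual.F1Sign2

end
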